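import Literature.NumberTheory.GaloisCohomology.Howard2004.DVRSettingChebotarevEigenclassesProofs
import Literature.NumberTheory.GaloisCohomology.Howard2004.EigenSelmerParityProofs
import Literature.NumberTheory.GaloisCohomology.Howard2004.TransportTransverseProofs
import Literature.NumberTheory.GaloisCohomology.Howard2004.TransverseScalarStableProofs
import Literature.NumberTheory.GaloisCohomology.Howard2004.DegreeTwoInertProofs
import Literature.NumberTheory.GaloisCohomology.Howard2004.DVRSettingPiRefinementResidual
import Literature.NumberTheory.GaloisCohomology.Howard2004.RelaxedSelmerIsotropyProofs
import Literature.NumberTheory.GaloisCohomology.SelmerStructureModifyOnePlaceProofs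
import Literature.NumberTheory.GaloisRepresentations.ContinuousH1OrderTwo
import Literature.NumberTheory.GaloisRepresentations.LocalGlobalCohomologyDualityProofs
import HarnessLib

/-!
# Howard 2004, Def. 1.5.2 / Lemma 1.6.4 on a `DVRSetting`: the residual level Selmer group
# `H¹_{F̄(n)}(K, T̄)` is `τ`-stable and `R_k`-stable, and splits into its `τ`-eigenparts (proofs file)

Topic `NumberTheory/GaloisCohomology/Howard2004` (sequel to `ResidualTauCohomologyProofs` (`τ_*` on `H¹(K, T̄)`,
class-level eigen-splitting, `τ`-stability of a Selmer group from an H.5(b)-shaped hypothesis),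
`TransportTransverseProofs` (the transverse condition is `τ`-stable), `TransverseScalarStableProofs` /
`GaloisCohomologyScalarActionLocalConditions` (scalar stability) and `ResidualLevelControlProofs` (the residual
structure `F̄(n) = (π̄_k)_* F` modified transversally at `n`)).  THEOREMS ONLY: no definition, no named fact,
no instance, no notation, no `sorry`.

B. Howard, *The Heegner point Kolyvagin system*, Compositio Math. 140 (2004) = arXiv:1202.6340.  Def. 1.5.2
(p. 9 L133–135): «`ρ(n)^±` the `R/𝔪`-dimension of `H¹_{F(n)}(K, T̄)^±`» presupposes that `τ` ACTS on
`H¹_{F(n)}(K, T̄)` (H.5(b) off `n`, and the transverse condition is Galois-conjugation stable at the inert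
primes of `n`); Lemma 1.6.4, Case i (p. 12 L3–6): «this `d` has nontrivial projection onto one of the
`τ`-eigencomponents, say `d⁺ ≠ 0`» presupposes the splitting `H¹_{F(n)}(K,T̄) = H¹_{F(n)}(K,T̄)⁺ ⊕ H¹_{F(n)}(K,T̄)⁻`
(`p` odd).  On a `DVRSetting S` with H.0–H.5, at level `k`, with
`F̄_k(n) := ((hy.h1 k).1.propagateStructure (S.t k).cond).modify (transverseStructure p S.ρbar S.jbar) ∅ ∅ n`
(the structure of `ResidualLevelControlProofs` §4) and `τ_* = semilinearH … (S.A k).θ …`: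

* §0 `smul_place_eq_self_of_isDegreeTwo` — a degree-two prime of a quadratic field is fixed by `Gal(K/ℚ)`
  (`λ = ℓ𝓞_K`); `sigma_smul_eq_self_of_mem_L` (the primes of `𝓛`).
* §1 `natCast_p_smul_residual_eq_zero`, `p_nsmul_galoisCohomology_rhobar_eq_zero` (`p · H¹(·, T̄) = 0`).
* §2 scalar stability over `R_k`: `isScalarStable_residualStructure[_modify]`, `scalarMapH1_mem_inf`,
  `scalarMapH1_mem_map_localization` (the stability witnesses the `Module.length` statements of Lemma 1.5.3 /
  Lemma 1.6.4 quote by name).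
* §3 **`semilinearH_mem_residualSelmer_modify`** — `τ_*` preserves `H¹_{F̄^a(n)}(K, T̄)` for `a, n` sets of
  `σ`-fixed primes (H.5(b) + `TransportTransverseProofs` + `H¹(K_∞, T̄) = 0` for `p` odd).
* §4 **`exists_eigen_decomposition_mem`** — `c = c⁺ + c⁻` INSIDE `H¹_{F̄^a(n)}(K, T̄)` with `τ_* c^± = ± c^±`
  (`c^± = ((p+1)/2)·(c ± τ_* c)`, integral combination, `p · c = 0`).

Cell `pub/bsd-print-x9`, G87 = Howard Thm. 1.6.1 (print leaf `stub_h161` of stmt-BirchSwinnertonDyer-22642); seat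
`bsd-line-x10b-p1-w6` g9, brick (ENGINE-hcheb) part 2a.  BSD is not proved by any of this.

References: [Howard2004HeegnerKolyvagin] §1.2, H.5, Def. 1.5.2, Lemma 1.6.4; [SerreGaloisCohomology1997] I §2.2, I §2.4.
-/

set_option autoImplicit false

noncomputable section

open Function NumberField IsDedekindDomain Field
open scoped NumberField ContRepresentation Classical Pointwise

namespace Literature.NumberTheory.GaloisCohomology.Howard2004

open Literature.NumberTheory.GaloisRepresentations
open Literature.NumberTheory.GaloisRepresentations.DiscreteGaloisModule
open Literature.NumberTheory.EllipticCurves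

/-! ## §0 Degree-two primes of a quadratic field are `Gal(K/ℚ)`-fixed -/

section DegreeTwo

variable {K : Type} [Field K] [NumberField K]

/-- **A degree-two prime `λ` of a quadratic field is fixed by every automorphism of `K`**: `λ = ℓ𝓞_K` with `ℓ`
its residue characteristic (`DegreeTwoInertProofs`), and `σ(ℓ) = ℓ`.  Howard: the primes of `𝓛₀` are the inert
ones, `λ̄ = λ`. [cite: Howard2004HeegnerKolyvagin, §1.2 (arXiv:1202.6340 p. 6 L57–58)] -/
theorem smul_place_eq_self_of_isDegreeTwo (hK2 : Module.finrank ℚ K = 2) (σ : K ≃ₐ[ℚ] K)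
    {v : HeightOneSpectrum (𝓞 K)} (hv : IsDegreeTwo v) : σ • v = v := by
  have hprime := isPrime_span_residueChar_of_isDegreeTwo hK2 hv
  have hne : Ideal.span {((residueChar v : ℕ) : 𝓞 K)} ≠ ⊥ := by
    rw [Ne, Ideal.span_singleton_eq_bot, Nat.cast_eq_zero]
    exact (prime_residueChar v).ne_zero
  have hmax : (Ideal.span {((residueChar v : ℕ) : 𝓞 K)}).IsMaximal := hprime.isMaximal hne
  have heq : v.asIdeal = Ideal.span {((residueChar v : ℕ) : 𝓞 K)} :=
    (hmax.eq_of_le v.isPrime.ne_top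
      ((Ideal.span_singleton_le_iff_mem _).2 (natCast_residueChar_mem_asIdeal v))).symm
  apply HeightOneSpectrum.ext
  rw [Literature.NumberTheory.Automorphic.HeightOneSpectrum.smul_asIdeal, heq, Ideal.pointwise_smul_def,
    Ideal.map_span, Set.image_singleton, map_natCast]

end DegreeTwo

namespace DVRSetting

variable {p : ℕ} [Fact p.Prime] {K : Type} [Field K] [NumberField K]
  {R : Type} [CommRing R] [IsDomain R] [IsDiscreteValuationRing R] [Algebra ℤ_[p] R]
  {N : ℕ → Type} [∀ k, AddCommGroup (N k)] [∀ k, TopologicalSpace (N k)]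
  [∀ k, DiscreteTopology (N k)] [∀ k, Module R (N k)]
  {Rk : ℕ → Type} [∀ k, CommRing (Rk k)] [∀ k, IsLocalRing (Rk k)] [∀ k, TopologicalSpace (Rk k)]
  [∀ k, DiscreteTopology (Rk k)] [∀ k, Algebra ℤ_[p] (Rk k)] [∀ k, Algebra R (Rk k)]
  [∀ k, Module (Rk k) (N k)] [∀ k, IsScalarTower R (Rk k) (N k)]
  {Nbar : Type} [AddCommGroup Nbar] [TopologicalSpace Nbar] [DiscreteTopology Nbar]
  [∀ k, Module (Rk k) Nbar]
  {Nq : ℕ → Finset (HeightOneSpectrum (𝓞 K)) → Type} [∀ k n, AddCommGroup (Nq k n)]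
  [∀ k n, TopologicalSpace (Nq k n)] [∀ k n, DiscreteTopology (Nq k n)]
  [∀ k n, Module (Rk k) (Nq k n)] [∀ k n, Module R (Nq k n)]
  [∀ k n, IsScalarTower R (Rk k) (Nq k n)]

/-- **The primes of `𝓛` are `σ`-fixed** (`𝓛 ⊆ 𝓛₀(T)` consists of degree-two primes; `K` is imaginary quadratic).
[cite: Howard2004HeegnerKolyvagin, §1.2 and §1.6 (arXiv p. 6 L57–58, L97–99)] -/
theorem sigma_smul_eq_self_of_mem_L (S : DVRSetting p K R N Rk Nbar Nq) (hy : S.SatisfiesH)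
    {v : HeightOneSpectrum (𝓞 K)} (hv : v ∈ S.L) : S.cd.σ • v = v := by
  have h0 : v ∈ S.T.degreeTwoPrimes p := hy.L_subset hv
  rw [AdicTower.degreeTwoPrimes, Set.mem_iInter] at h0
  exact smul_place_eq_self_of_isDegreeTwo hy.imagQuad.1 S.cd.σ (h0 0).1

/-! ## §1 `p · T̄ = 0` and `p · H¹(·, T̄) = 0` -/

/-- `p · T̄ = 0` (`p ∈ 𝔪_R` and `𝔪 T̄ = 0`). [cite: Howard2004HeegnerKolyvagin, H.1 (arXiv p. 7 L59)] -/
theorem natCast_p_smul_residual_eq_zero (S : DVRSetting p K R N Rk Nbar Nq) (hy : S.SatisfiesH) (k : ℕ)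
    (x : Nbar) : ((p : ℕ) : Rk k) • x = 0 := by
  rw [← map_natCast (algebraMap R (Rk k))]
  exact S.algebraMap_smul_residual_eq_zero_of_mem hy k (S.natCast_p_mem_maximalIdeal hy) x

/-- `p · x = 0` for `x ∈ T̄` (integer multiple). [cite: Howard2004HeegnerKolyvagin, H.1 (arXiv p. 7 L59)] -/
theorem p_nsmul_residual_eq_zero (S : DVRSetting p K R N Rk Nbar Nq) (hy : S.SatisfiesH) (x : Nbar) :
    p • x = 0 := by
  rw [← Nat.cast_smul_eq_nsmul (Rk 0)]
  exact S.natCast_p_smul_residual_eq_zero hy 0 x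

/-- **`p · H¹(K, T̄) = 0`.** [cite: Howard2004HeegnerKolyvagin, H.1 (arXiv p. 7 L59)] [cite: SerreGaloisCohomology1997, I §2.2] -/
theorem p_nsmul_galoisCohomology_rhobar_eq_zero (S : DVRSetting p K R N Rk Nbar Nq) (hy : S.SatisfiesH)
    (c : galoisCohomology S.ρbar 1) : p • c = 0 :=
  galoisCohomology.nsmul_eq_zero_of_forall S.ρbar (S.p_nsmul_residual_eq_zero hy) c

/-- **`H¹(K_w, T̄) = 0` at an infinite place** (`p` odd kills `T̄`, and `2` kills `H¹(K_w, ·)`).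
[cite: SerreGaloisCohomology1997, I §2.4] -/
theorem galoisCohomology_rhobar_toLocal_inl_eq_zero (S : DVRSetting p K R N Rk Nbar Nq) (hy : S.SatisfiesH)
    (w : InfinitePlace K) (x : galoisCohomology (S.ρbar.toLocal (Sum.inl w)) 1) : x = 0 := by
  have hp : p.Prime := Fact.out
  exact eq_zero_of_odd_nsmul_galoisCohomology_one_toLocal_inl S.ρbar w (hp.odd_of_ne_two hy.p_odd) x
    (galoisCohomology.nsmul_eq_zero_of_forall (S.ρbar.toLocal (Sum.inl w)) (S.p_nsmul_residual_eq_zero hy) x)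

/-! ## §2 Scalar stability over `R_k` -/

/-- **The residual structure `F̄ = (π̄_k)_* F` is `R_k`-stable** (T4: the conditions of `F` are `R`-submodules;
`H¹(K_v, π̄_k)` commutes with the scalars). [cite: Howard2004HeegnerKolyvagin, Def. 1.1.1 and Def. 1.1.3 (arXiv p. 5 L20–21, L93–99)] -/
theorem isScalarStable_residualStructure (S : DVRSetting p K R N Rk Nbar Nq) (hy : S.SatisfiesH) (k : ℕ) :
    ((hy.h1 k).1.propagateStructure (S.t k).cond).IsScalarStable (S.isScalarLinear_rhobar hy k) :=
  (hy.h1 k).1.isScalarStable_propagateStructure (hy.scalarLinear k) (hy.isScalarStable_cond k)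

/-- **Every modification `F̄^a_b(c)` of the residual structure is `R_k`-stable** (the transverse conditions are
`R_k`-submodules). [cite: Howard2004HeegnerKolyvagin, Def. 1.1.1 and Def. 1.2.2 (arXiv p. 5 L20–21, p. 6 L101–125)] -/
theorem isScalarStable_residualStructure_modify (S : DVRSetting p K R N Rk Nbar Nq) (hy : S.SatisfiesH) (k : ℕ)
    (a b c : Finset (HeightOneSpectrum (𝓞 K))) :
    (((hy.h1 k).1.propagateStructure (S.t k).cond).modify (transverseStructure p S.ρbar S.jbar) a b c).IsScalarStable
      (S.isScalarLinear_rhobar hy k) :=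
  (S.isScalarStable_residualStructure hy k).modify (S.isScalarLinear_rhobar hy k)
    (isScalarStable_transverseStructure p (S.isScalarLinear_rhobar hy k) S.jbar) a b c

/-- The Selmer group of `F̄^a_b(c)` is stable under every `H¹(r•)`, `r ∈ R_k`.
[cite: Howard2004HeegnerKolyvagin, Def. 1.1.10 and Def. 1.2.2 (arXiv p. 6 L10–33, L101–125)] -/
theorem scalarMapH1_mem_residualSelmer_modify (S : DVRSetting p K R N Rk Nbar Nq) (hy : S.SatisfiesH) (k : ℕ)
    (a b c : Finset (HeightOneSpectrum (𝓞 K))) :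
    ∀ (r : Rk k) {x : galoisCohomology S.ρbar 1},
      x ∈ (((hy.h1 k).1.propagateStructure (S.t k).cond).modify (transverseStructure p S.ρbar S.jbar)
        a b c).selmerGroup →
      galoisCohomology.scalarMapH1 S.ρbar (S.isScalarLinear_rhobar hy k) r x ∈
        (((hy.h1 k).1.propagateStructure (S.t k).cond).modify (transverseStructure p S.ρbar S.jbar)
          a b c).selmerGroup :=
  fun r _ hx => SelmerStructure.scalarMapH1_mem_selmerGroup (S.isScalarLinear_rhobar hy k)
    (S.isScalarStable_residualStructure_modify hy k a b c) r hx

end DVRSetting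

/-! ### Generic stability bookkeeping (intersections, eigen-subgroups, local images) -/

section Stable

variable {K : Type} [Field K] [NumberField K] {M : Type} [AddCommGroup M] [TopologicalSpace M]
  [DiscreteTopology M] {R : Type} [CommRing R] [Module R M]

omit [NumberField K] in
/-- An intersection of two `H¹(r•)`-stable subgroups is stable. [cite: Howard2004HeegnerKolyvagin, Def. 1.1.1 (arXiv p. 5 L20–21)] -/
theorem scalarMapH1_mem_inf (ρ : DiscreteGaloisModule K M) (hρ : ρ.IsScalarLinear R)
    {A B : AddSubgroup (galoisCohomology ρ 1)}
    (hA : ∀ (r : R) {x}, x ∈ A → galoisCohomology.scalarMapH1 ρ hρ r x ∈ A)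
    (hB : ∀ (r : R) {x}, x ∈ B → galoisCohomology.scalarMapH1 ρ hρ r x ∈ B) :
    ∀ (r : R) {x}, x ∈ A ⊓ B → galoisCohomology.scalarMapH1 ρ hρ r x ∈ A ⊓ B :=
  fun r _ hx => ⟨hA r hx.1, hB r hx.2⟩

/-- The image under `loc_q` of an `H¹(r•)`-stable subgroup is stable (`loc_q` commutes with the scalars).
[cite: Howard2004HeegnerKolyvagin, Def. 1.1.1 (arXiv p. 5 L20–21)] [cite: SerreGaloisCohomology1997, I §2.4] -/
theorem scalarMapH1_mem_map_localization (ρ : DiscreteGaloisModule K M) (hρ : ρ.IsScalarLinear R) (q : Place K)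
    {A : AddSubgroup (galoisCohomology ρ 1)}
    (hA : ∀ (r : R) {x}, x ∈ A → galoisCohomology.scalarMapH1 ρ hρ r x ∈ A) :
    ∀ (r : R) {y}, y ∈ A.map (galoisCohomology.localization ρ q 1) →
      galoisCohomology.scalarMapH1 (ρ.toLocal q) (hρ.restrictField (Place.Completion q)) r y ∈
        A.map (galoisCohomology.localization ρ q 1) := by
  rintro r _ ⟨x, hx, rfl⟩
  exact ⟨_, hA r hx, galoisCohomology.localization_scalarMapH1 hρ q r x⟩

end Stable

namespace DVRSetting

variable {p : ℕ} [Fact p.Prime] {K : Type} [Field K] [NumberField K]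
  {R : Type} [CommRing R] [IsDomain R] [IsDiscreteValuationRing R] [Algebra ℤ_[p] R]
  {N : ℕ → Type} [∀ k, AddCommGroup (N k)] [∀ k, TopologicalSpace (N k)]
  [∀ k, DiscreteTopology (N k)] [∀ k, Module R (N k)]
  {Rk : ℕ → Type} [∀ k, CommRing (Rk k)] [∀ k, IsLocalRing (Rk k)] [∀ k, TopologicalSpace (Rk k)]
  [∀ k, DiscreteTopology (Rk k)] [∀ k, Algebra ℤ_[p] (Rk k)] [∀ k, Algebra R (Rk k)]
  [∀ k, Module (Rk k) (N k)] [∀ k, IsScalarTower R (Rk k) (N k)]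
  {Nbar : Type} [AddCommGroup Nbar] [TopologicalSpace Nbar] [DiscreteTopology Nbar]
  [∀ k, Module (Rk k) Nbar]
  {Nq : ℕ → Finset (HeightOneSpectrum (𝓞 K)) → Type} [∀ k n, AddCommGroup (Nq k n)]
  [∀ k n, TopologicalSpace (Nq k n)] [∀ k n, DiscreteTopology (Nq k n)]
  [∀ k n, Module (Rk k) (Nq k n)] [∀ k n, Module R (Nq k n)]
  [∀ k n, IsScalarTower R (Rk k) (Nq k n)]

/-- The `(+)`-eigen-subgroup `ker(τ_* − id)` intersected with a modified residual Selmer group is `R_k`-stable —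
the stability witness of `H¹_{F̄^a(n)}(K, T̄)⁺` as an `R_k`-submodule (Def. 1.5.2).
[cite: Howard2004HeegnerKolyvagin, Def. 1.5.2 (arXiv p. 9 L133–135)] -/
theorem scalarMapH1_mem_residualSelmer_inf_ker_sub (S : DVRSetting p K R N Rk Nbar Nq) (hy : S.SatisfiesH)
    (k : ℕ) (a b c : Finset (HeightOneSpectrum (𝓞 K))) :
    ∀ (r : Rk k) {x : galoisCohomology S.ρbar 1},
      x ∈ (((hy.h1 k).1.propagateStructure (S.t k).cond).modify (transverseStructure p S.ρbar S.jbar)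
          a b c).selmerGroup ⊓
        (semilinearH S.cd.isLift (S.A k).θ.toAddMonoidHom (S.A k).isSemilinear 1 - AddMonoidHom.id _).ker →
      galoisCohomology.scalarMapH1 S.ρbar (S.isScalarLinear_rhobar hy k) r x ∈
        (((hy.h1 k).1.propagateStructure (S.t k).cond).modify (transverseStructure p S.ρbar S.jbar)
            a b c).selmerGroup ⊓
          (semilinearH S.cd.isLift (S.A k).θ.toAddMonoidHom (S.A k).isSemilinear 1 - AddMonoidHom.id _).ker :=
  scalarMapH1_mem_inf S.ρbar (S.isScalarLinear_rhobar hy k) (S.scalarMapH1_mem_residualSelmer_modify hy k a b c)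
    (fun r _ hc => ResidualTau.scalarMapH1_mem_ker_sub (S.A k) (S.isScalarLinear_rhobar hy k) r hc)

/-- The `(−)`-eigen-subgroup `ker(τ_* + id)` intersected with a modified residual Selmer group is `R_k`-stable
(`H¹_{F̄^a(n)}(K, T̄)⁻`, Def. 1.5.2). [cite: Howard2004HeegnerKolyvagin, Def. 1.5.2 (arXiv p. 9 L133–135)] -/
theorem scalarMapH1_mem_residualSelmer_inf_ker_add (S : DVRSetting p K R N Rk Nbar Nq) (hy : S.SatisfiesH)
    (k : ℕ) (a b c : Finset (HeightOneSpectrum (𝓞 K))) :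
    ∀ (r : Rk k) {x : galoisCohomology S.ρbar 1},
      x ∈ (((hy.h1 k).1.propagateStructure (S.t k).cond).modify (transverseStructure p S.ρbar S.jbar)
          a b c).selmerGroup ⊓
        (semilinearH S.cd.isLift (S.A k).θ.toAddMonoidHom (S.A k).isSemilinear 1 + AddMonoidHom.id _).ker →
      galoisCohomology.scalarMapH1 S.ρbar (S.isScalarLinear_rhobar hy k) r x ∈
        (((hy.h1 k).1.propagateStructure (S.t k).cond).modify (transverseStructure p S.ρbar S.jbar)
            a b c).selmerGroup ⊓
          (semilinearH S.cd.isLift (S.A k).θ.toAddMonoidHom (S.A k).isSemilinear 1 + AddMonoidHom.id _).ker :=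
  scalarMapH1_mem_inf S.ρbar (S.isScalarLinear_rhobar hy k) (S.scalarMapH1_mem_residualSelmer_modify hy k a b c)
    (fun r _ hc => ResidualTau.scalarMapH1_mem_ker_add (S.A k) (S.isScalarLinear_rhobar hy k) r hc)

/-! ## §3 `τ_*` preserves `H¹_{F̄^a(n)}(K, T̄)` -/

/-- **H.5(b) for the modified residual structure `F̄^a(n)`**, `a` and `n` sets of `σ`-FIXED primes (e.g. primes of
`𝓛`): at every finite `v`, `θ_* ∘ transport_v` carries `F̄^a(n)_{σ v}` into `F̄^a(n)_v` — off `a ∪ n` this is H.5(b)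
for `F̄`, at `v ∈ n` the transverse condition is transported to itself (`TransportTransverseProofs`), at `v ∈ a`
the condition is everything. [cite: Howard2004HeegnerKolyvagin, H.5(b) and Def. 1.2.2 (arXiv p. 7 L96–97, p. 6 L101–125)] -/
theorem map_thetaH1_transportH1_residualStructure_modify_le (S : DVRSetting p K R N Rk Nbar Nq) (hy : S.SatisfiesH)
    (k : ℕ) {a n : Finset (HeightOneSpectrum (𝓞 K))} (ha : ∀ w ∈ a, S.cd.σ • w = w)
    (hn : ∀ w ∈ n, S.cd.σ • w = w) (v : HeightOneSpectrum (𝓞 K)) :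
    ((((hy.h1 k).1.propagateStructure (S.t k).cond).modify (transverseStructure p S.ρbar S.jbar) a ∅ n)
        (Sum.inr (S.cd.σ • v))).map (((S.A k).thetaH1 (Sum.inr v)).comp (S.cd.transportH1 S.ρbar v)) ≤
      (((hy.h1 k).1.propagateStructure (S.t k).cond).modify (transverseStructure p S.ρbar S.jbar) a ∅ n)
        (Sum.inr v) := by
  -- `σ w ∈ a ↔ w ∈ a`, and the same for `n`, since both consist of `σ`-fixed primes and `σ² = 1`
  have hmemσ : ∀ {s : Finset (HeightOneSpectrum (𝓞 K))}, (∀ w ∈ s, S.cd.σ • w = w) →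
      (S.cd.σ • v ∈ s ↔ v ∈ s) := by
    intro s hs
    constructor
    · intro h
      have h' := hs _ h
      rw [S.cd.smul_smul_place v] at h'
      rwa [← h'] at h
    · intro h
      rwa [hs v h]
  by_cases hva : v ∈ a
  · rw [SelmerStructure.modify_inr_of_mem_relaxed _ _ hva]
    exact le_top
  have hσa : S.cd.σ • v ∉ a := fun h => hva ((hmemσ ha).1 h)
  by_cases hvn : v ∈ n
  · have hfix : S.cd.σ • v = v := hn v hvn
    have hσn : S.cd.σ • v ∈ n := (hmemσ hn).2 hvn
    rw [SelmerStructure.modify_inr_of_mem_transverse _ _ hσa (Finset.notMem_empty _) hσn,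
      SelmerStructure.modify_inr_of_mem_transverse _ _ hva (Finset.notMem_empty _) hvn,
      transverseStructure_inr, transverseStructure_inr]
    have hch : ringChar (𝓞 K ⧸ (S.cd.σ • v).asIdeal) = ringChar (𝓞 K ⧸ v.asIdeal) := by rw [hfix]
    rw [hch]
    have hℓ : ringChar (𝓞 K ⧸ v.asIdeal) ≠ 0 := (prime_residueChar v).ne_zero
    rintro _ ⟨y, hy', rfl⟩
    rw [AddMonoidHom.comp_apply]
    exact (S.A k).thetaH1_mem_transverseCondition _ S.jbar v
      (S.cd.transportH1_mem_transverseCondition_of_isImaginaryQuadratic hy.imagQuad S.ρbar S.jbar hℓ v hy')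
  · have hσn : S.cd.σ • v ∉ n := fun h => hvn ((hmemσ hn).1 h)
    rw [SelmerStructure.modify_inr_of_not_mem _ _ hσa (Finset.notMem_empty _) hσn,
      SelmerStructure.modify_inr_of_not_mem _ _ hva (Finset.notMem_empty _) hvn]
    exact (hy.h5b k v).le

/-- **`τ_*` preserves `H¹_{F̄^a(n)}(K, T̄)`** for `a`, `n` sets of `σ`-fixed primes (in particular `H¹_{F̄(n)}(K, T̄)`,
`a = ∅`, and the relaxed `H¹_{F̄^λ(n)}(K, T̄)`): so `τ` ACTS on these groups and their `±`-eigenparts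
`H¹_{F̄(n)}(K,T̄)^± = H¹_{F̄(n)}(K,T̄) ⊓ ker(τ_* ∓ 1)` are what Def. 1.5.2 calls `𝓗̄(n)^±`.
[cite: Howard2004HeegnerKolyvagin, H.5(b) and Def. 1.5.2 (arXiv p. 7 L96–97; p. 9 L133–135)] -/
theorem semilinearH_mem_residualSelmer_modify (S : DVRSetting p K R N Rk Nbar Nq) (hy : S.SatisfiesH) (k : ℕ)
    {a n : Finset (HeightOneSpectrum (𝓞 K))} (ha : ∀ w ∈ a, S.cd.σ • w = w) (hn : ∀ w ∈ n, S.cd.σ • w = w)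
    {c : galoisCohomology S.ρbar 1}
    (hc : c ∈ (((hy.h1 k).1.propagateStructure (S.t k).cond).modify (transverseStructure p S.ρbar S.jbar)
      a ∅ n).selmerGroup) :
    semilinearH S.cd.isLift (S.A k).θ.toAddMonoidHom (S.A k).isSemilinear 1 c ∈
      (((hy.h1 k).1.propagateStructure (S.t k).cond).modify (transverseStructure p S.ρbar S.jbar)
        a ∅ n).selmerGroup :=
  ResidualTau.semilinearH_mem_selmerGroup (S.A k)
    (fun v => S.map_thetaH1_transportH1_residualStructure_modify_le hy k ha hn v)
    (fun w x => by
      rw [S.galoisCohomology_rhobar_toLocal_inl_eq_zero hy w x]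
      exact AddSubgroup.zero_mem _)
    hc

/-! ## §4 The eigen-splitting inside `H¹_{F̄^a(n)}(K, T̄)` -/

/-- **`c = c⁺ + c⁻` inside `H¹_{F̄^a(n)}(K, T̄)`** (`p` odd; `a`, `n` sets of `σ`-fixed primes): with the integer
`u = (p+1)/2` (so `2u ≡ 1 mod p`, and `p` kills `H¹(K, T̄)`), `c⁺ = u·(c + τ_* c)` and `c⁻ = u·(c − τ_* c)` lie in the
same Selmer group, `τ_* c⁺ = c⁺`, `τ_* c⁻ = −c⁻`, `c = c⁺ + c⁻` — «this `d` has nontrivial projection onto one of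
the `τ`-eigencomponents». [cite: Howard2004HeegnerKolyvagin, §1.5 preamble and Lemma 1.6.4 Case i (arXiv p. 9 L122–126, p. 12 L3–6)] -/
theorem exists_eigen_decomposition_mem (S : DVRSetting p K R N Rk Nbar Nq) (hy : S.SatisfiesH) (k : ℕ)
    {a n : Finset (HeightOneSpectrum (𝓞 K))} (ha : ∀ w ∈ a, S.cd.σ • w = w) (hn : ∀ w ∈ n, S.cd.σ • w = w)
    {c : galoisCohomology S.ρbar 1}
    (hc : c ∈ (((hy.h1 k).1.propagateStructure (S.t k).cond).modify (transverseStructure p S.ρbar S.jbar)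
      a ∅ n).selmerGroup) :
    ∃ cp cm : galoisCohomology S.ρbar 1,
      cp ∈ (((hy.h1 k).1.propagateStructure (S.t k).cond).modify (transverseStructure p S.ρbar S.jbar)
        a ∅ n).selmerGroup ∧
      cm ∈ (((hy.h1 k).1.propagateStructure (S.t k).cond).modify (transverseStructure p S.ρbar S.jbar)
        a ∅ n).selmerGroup ∧
      semilinearH S.cd.isLift (S.A k).θ.toAddMonoidHom (S.A k).isSemilinear 1 cp = cp ∧
      semilinearH S.cd.isLift (S.A k).θ.toAddMonoidHom (S.A k).isSemilinear 1 cm = -cm ∧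
      c = cp + cm := by
  have hp : p.Prime := Fact.out
  obtain ⟨m, hm⟩ : Odd p := hp.odd_of_ne_two hy.p_odd
  -- `u = m + 1 = (p + 1) / 2`
  have hτc := S.semilinearH_mem_residualSelmer_modify hy k ha hn hc
  refine ⟨(m + 1) • (c + semilinearH S.cd.isLift (S.A k).θ.toAddMonoidHom (S.A k).isSemilinear 1 c),
    (m + 1) • (c - semilinearH S.cd.isLift (S.A k).θ.toAddMonoidHom (S.A k).isSemilinear 1 c),
    AddSubgroup.nsmul_mem _ (AddSubgroup.add_mem _ hc hτc) _,
    AddSubgroup.nsmul_mem _ (AddSubgroup.sub_mem _ hc hτc) _, ?_, ?_, ?_⟩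
  · rw [map_nsmul, map_add, (S.A k).semilinearH_semilinearH]
    congr 1
    exact add_comm _ _
  · rw [map_nsmul, map_sub, (S.A k).semilinearH_semilinearH, ← smul_neg, neg_sub]
  · rw [← smul_add, add_add_sub_cancel, ← two_nsmul, smul_smul]
    have h2 : (m + 1) * 2 = p + 1 := by omega
    rw [h2, add_nsmul, one_nsmul, S.p_nsmul_galoisCohomology_rhobar_eq_zero hy c, zero_add]

/-- **A non-zero class of `H¹_{F̄^a(n)}(K, T̄)` has a non-zero eigencomponent in the same group** — the form used in
Lemma 1.6.4: from `d̄ ≠ 0` either `d̄⁺ ≠ 0` or `d̄⁻ ≠ 0`. [cite: Howard2004HeegnerKolyvagin, Lemma 1.6.4 Case i (arXiv p. 12 L3–6)] -/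
theorem exists_eigen_decomposition_mem_ne_zero (S : DVRSetting p K R N Rk Nbar Nq) (hy : S.SatisfiesH) (k : ℕ)
    {a n : Finset (HeightOneSpectrum (𝓞 K))} (ha : ∀ w ∈ a, S.cd.σ • w = w) (hn : ∀ w ∈ n, S.cd.σ • w = w)
    {c : galoisCohomology S.ρbar 1}
    (hc : c ∈ (((hy.h1 k).1.propagateStructure (S.t k).cond).modify (transverseStructure p S.ρbar S.jbar)
      a ∅ n).selmerGroup) (hc0 : c ≠ 0) :
    ∃ cp cm : galoisCohomology S.ρbar 1,
      cp ∈ (((hy.h1 k).1.propagateStructure (S.t k).cond).modify (transverseStructure p S.ρbar S.jbar)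
        a ∅ n).selmerGroup ∧
      cm ∈ (((hy.h1 k).1.propagateStructure (S.t k).cond).modify (transverseStructure p S.ρbar S.jbar)
        a ∅ n).selmerGroup ∧
      semilinearH S.cd.isLift (S.A k).θ.toAddMonoidHom (S.A k).isSemilinear 1 cp = cp ∧
      semilinearH S.cd.isLift (S.A k).θ.toAddMonoidHom (S.A k).isSemilinear 1 cm = -cm ∧
      c = cp + cm ∧ (cp ≠ 0 ∨ cm ≠ 0) := by
  obtain ⟨cp, cm, hcp, hcm, hτp, hτm, rfl⟩ := S.exists_eigen_decomposition_mem hy k ha hn hc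
  refine ⟨cp, cm, hcp, hcm, hτp, hτm, rfl, ?_⟩
  by_contra h
  rw [not_or, not_not, not_not] at h
  exact hc0 (by rw [h.1, h.2, add_zero])

end DVRSetting

end Literature.NumberTheory.GaloisCohomology.Howard2004

end
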